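import Literature.Combinatorics.LorentzianPolynomials.Basic
import Mathlib.RingTheory.MvPolynomial.Symmetric.Defs
import HarnessLib

/-!
# Elementary symmetric polynomials are Lorentzian (Brändén–Huh 2020, Example 2.27)

Layer `Literature/Combinatorics/LorentzianPolynomials`, namespace `Literature.Combinatorics.LorentzianPolynomials`;
lane `lit-hodgefound` (Track 2 foundations library), seat p16, generation 27 (row g27-#5). Sequel of `Basic.lean` (row
g27-#1: `IsMConvex`, `normCoeff`, `iterPderiv`, `hessian`, `lorentzian σ d` = `L^d_n` by Brändén–Huh's Definition 2.6 and
its second form `mem_lorentzian_iff_forall_iterPderiv`: `L^d_n = {f ∈ M^d_n | ∂^α f ∈ L²_n for all α ∈ Δ^{d-2}_n}`).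
The sibling `Combinatorics/StablePolynomials/ElementarySymmetric.lean` proves the STABILITY of `e_d` (Choe–Oxley–Sokal–Wagner;
Borcea–Brändén) — a different statement, not imported here.

## Source (verbatim) — P. Brändén, J. Huh, *Lorentzian polynomials* [BrandenHuh2019] (held `paper:arxiv-1902.03719`)

* §2.4, after Theorem 2.25 ("a degree `d` homogeneous polynomial `f` with nonnegative coefficients is Lorentzian if and
  only if the support of `f` is M-convex and `∂^α f` has at most one positive eigenvalue for every `α ∈ Δ^{d-2}_n`"),
  **Example 2.27**: "Using Theorem 2.25, it is straightforward to check that elementary symmetric polynomials are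
  Lorentzian. In fact, one can show more generally that all normalized Schur polynomials are Lorentzian [HMMS19]. Any
  elementary symmetric polynomial is stable [COSW04], but a normalized Schur polynomial need not be stable [HMMS19]."
* §2.2 (p. 11): "A matroid `M` on `[n]` is a nonempty family of subsets `B` of `[n]`, called the set of bases of `M`, that
  satisfies the exchange property: For any `B_1, B_2 ∈ B` and `i ∈ B_1 ∖ B_2`, there is `j ∈ B_2 ∖ B_1` such that
  `(B_1 ∖ i) ∪ j ∈ B`. […] More generally, following [Mur03], we define a subset `J ⊆ ℕ^n` to be M-convex if […] For any
  `α, β ∈ J` and any index `i` satisfying `α_i > β_i`, there is an index `j` satisfying `α_j < β_j` and `α - e_i + e_j ∈ J`."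
  (the supports below are the bases of uniform matroids); Definition 2.6 (`L^0_n`, `L^1_n`, `L²_n`, the recursion).

## The check, carried out (variables indexed by a finite type `σ`; `T ⊆ σ` a finite set of variables)

Write `e_d(T) = Σ_{t ⊆ T, #t = d} Π_{i ∈ t} w_i` (`esymmOn T d`; Mathlib's `MvPolynomial.esymm σ ℝ d` is `e_d(σ)`,
`esymm_eq_esymmOn`) and `e_t = Σ_{i ∈ t} e_i ∈ ℕ^σ` for the `0/1` exponent of a subset (`ind t`). Then:
(1) `coeff_{β} e_d(T) = 1` if `β` is squarefree (`β_i ≤ 1`) of degree `d` with support in `T`, and `0` otherwise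
(`coeff_esymmOn`); normalized and ordinary coefficients agree (`normCoeff_esymmOn`, as `β! = 1` on squarefree `β`).
(2) The support — the bases of the uniform matroid `U_{d,T}` — is M-convex (`isMConvex_setOf_squarefree`: if `α_i = 1`,
`β_i = 0`, some `j` has `α_j = 0`, `β_j = 1` since `|α| = |β|`, and `α - e_i + e_j` is again squarefree of degree `d` in `T`).
(3) `∂^{e_S} e_d(T) = e_{d-#S}(T ∖ S)` for `S ⊆ T` (`iterPderiv_ind_esymmOn`), and `∂^α e_d(T) = 0` when `α` is not
squarefree or not supported in `T` (`iterPderiv_esymmOn_eq_zero`) — the normalized coefficients of `∂^α f` are those of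
`f` shifted by `α` (`Basic`: `normCoeff_iterPderiv`).
(4) The Hessian of `e_2(U)` is `𝓗_{ij} = [i ≠ j, i, j ∈ U]` (`hessian_esymmOn_two`), i.e. the quadratic form
`x ↦ (Σ_{i∈U} x_i)² - Σ_{i∈U} x_i²`, which is `≤ 0` on the hyperplane `Σ_{i∈U} x_i = 0`; hence (Sylvester, Mathlib's
`QuadraticForm.sigPos_add_finrank_le_of_nonpos`) it has at most one positive eigenvalue
(`sigPos_hessian_esymmOn_two_le_one`) and `e_2(U) ∈ L²_n` (`esymmOn_two_mem_lorentzian`).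
(5) By the second form of Definition 2.6, **`esymmOn_mem_lorentzian`**: `e_d(T) ∈ L^d_n` for all `d`, `T`; in particular
**`esymm_mem_lorentzian`**: `e_d(w_1, …, w_n) ∈ L^d_n` (Example 2.27). Degrees `0`, `1` directly (`L^0 = ` nonnegative
constants, `L^1 = ` nonnegative linear forms).

Two definitions with bodies (`ind`, `esymmOn`), theorems otherwise; no `sorry`, no named fact (net debt 0). NOT claimed: the
normalized Schur polynomials of [HMMS19].

## References

* [BrandenHuh2019] P. Brändén, J. Huh, *Lorentzian polynomials*, Ann. of Math. (2) 192 (2020) 821–891, arXiv:1902.03719 —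
  §2.2 (p. 11: matroids, M-convex sets), Def. 2.6; §2.4 Thm. 2.25, Example 2.27.
-/

noncomputable section

open MvPolynomial Finsupp Finset
open scoped Nat

namespace Literature.Combinatorics.LorentzianPolynomials

variable {σ : Type*}

/-! ## §1 The `0/1` exponent `e_t = Σ_{i ∈ t} e_i` of a finite set of variables -/

section Ind

/-- **The exponent vector of a subset**: `e_t = Σ_{i ∈ t} e_i ∈ ℕ^σ`, so that `w^{e_t} = Π_{i ∈ t} w_i` (the squarefree
monomials; Brändén–Huh's `e_i` "the standard unit vectors", bases `B` of a matroid read as `0/1` vectors).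
[cite: BrandenHuh2019, §2.2 (p. 11, "`α - e_i + e_j`"; bases of a matroid)] -/
def ind (t : Finset σ) : σ →₀ ℕ := ∑ i ∈ t, Finsupp.single i 1

/-- `e_t = Σ_{i ∈ t} e_i`. [cite: BrandenHuh2019, §2.2 (p. 11)] -/
theorem ind_def (t : Finset σ) : ind t = ∑ i ∈ t, Finsupp.single i 1 := rfl

/-- `(e_t)_i = [i ∈ t]`. [cite: BrandenHuh2019, §2.2 (p. 11)] -/
theorem ind_apply [DecidableEq σ] (t : Finset σ) (i : σ) : ind t i = if i ∈ t then 1 else 0 := by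
  rw [ind, Finsupp.finsetSum_apply]
  simp_rw [Finsupp.single_apply]
  exact Finset.sum_ite_eq' t i fun _ ↦ 1

/-- `(e_t)_i ≤ 1`: the exponent of a subset is squarefree. [cite: BrandenHuh2019, §2.2 (p. 11)] -/
theorem ind_le_one (t : Finset σ) (i : σ) : ind t i ≤ 1 := by
  classical
  rw [ind_apply]
  split_ifs <;> simp

/-- `supp e_t = t`. [cite: BrandenHuh2019, §2.2 (p. 11, "The support of […]")] -/
theorem support_ind (t : Finset σ) : (ind t).support = t := by
  classical
  ext i
  rw [Finsupp.mem_support_iff, ind_apply]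
  split_ifs with h <;> simp [h]

/-- `t ↦ e_t` is injective. [cite: BrandenHuh2019, §2.2 (p. 11)] -/
theorem ind_injective : Function.Injective (ind : Finset σ → σ →₀ ℕ) := fun s t h ↦ by
  rw [← support_ind s, h, support_ind]

/-- `|e_t| = #t`. [cite: BrandenHuh2019, §2.2 (p. 11)] -/
theorem degree_ind (t : Finset σ) : (ind t).degree = t.card := by
  rw [ind, map_sum]
  simp [Finsupp.degree_single]

/-- A squarefree exponent is the exponent of its support: `β = e_{supp β}` when all `β_i ≤ 1`.
[cite: BrandenHuh2019, §2.2 (p. 11)] -/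
theorem eq_ind_support {β : σ →₀ ℕ} (h : ∀ i, β i ≤ 1) : β = ind β.support := by
  classical
  ext i
  rw [ind_apply]
  by_cases hi : i ∈ β.support
  · rw [if_pos hi]
    have h1 := h i
    have h2 := Finsupp.mem_support_iff.1 hi
    omega
  · rw [if_neg hi]
    exact Finsupp.notMem_support_iff.1 hi

/-- The degree of a squarefree exponent is the size of its support. [cite: BrandenHuh2019, §2.2 (p. 11)] -/
theorem degree_eq_card_support {β : σ →₀ ℕ} (h : ∀ i, β i ≤ 1) : β.degree = β.support.card := by
  conv_lhs => rw [eq_ind_support h]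
  exact degree_ind _

/-- `e_{insert j t} = e_t + e_j` for `j ∉ t`. [cite: BrandenHuh2019, §2.2 (p. 11, "`(B_1 ∖ i) ∪ j`")] -/
theorem ind_insert [DecidableEq σ] {t : Finset σ} {j : σ} (h : j ∉ t) :
    ind (insert j t) = ind t + Finsupp.single j 1 := by
  rw [ind, ind, Finset.sum_insert h, add_comm]

/-- `e_{t ∖ i} + e_i = e_t` for `i ∈ t`. [cite: BrandenHuh2019, §2.2 (p. 11, "`(B_1 ∖ i) ∪ j`")] -/
theorem ind_erase_add [DecidableEq σ] {t : Finset σ} {i : σ} (h : i ∈ t) :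
    ind (t.erase i) + Finsupp.single i 1 = ind t := by
  rw [ind, ind, Finset.sum_erase_add _ _ h]

/-- `e_{t ∖ s} + e_s = e_t` for `s ⊆ t`. [cite: BrandenHuh2019, §2.2 (p. 11)] -/
theorem ind_sdiff_add [DecidableEq σ] {s t : Finset σ} (h : s ⊆ t) : ind (t \ s) + ind s = ind t := by
  rw [ind, ind, ind, Finset.sum_sdiff h]

/-- `e_t! = Π_i (e_t)_i! = 1`. [cite: BrandenHuh2019, §2.2 (p. 11, "`α! = Π_i α_i!`")] -/
theorem factorialProd_ind [Fintype σ] (t : Finset σ) : factorialProd (ind t) = 1 := by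
  classical
  rw [factorialProd]
  refine Finset.prod_eq_one fun i _ ↦ ?_
  rw [ind_apply]
  split_ifs <;> simp

/-- On squarefree exponents normalized and ordinary coefficients agree: `c_β(f) = coeff_β(f)` (`β! = 1`).
[cite: BrandenHuh2019, §2.2 (p. 11, normalized form `Σ (c_α/α!) w^α`)] -/
theorem normCoeff_eq_coeff_of_le_one [Fintype σ] {β : σ →₀ ℕ} (h : ∀ i, β i ≤ 1) (f : MvPolynomial σ ℝ) :
    normCoeff β f = coeff β f := by
  rw [normCoeff, eq_ind_support h, factorialProd_ind, one_mul]

end Ind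

/-! ## §2 Squarefree exponents of fixed degree (bases of a uniform matroid) form an M-convex set -/

section Squarefree

/-- **The squarefree exponents of degree `d` supported in `T` form an M-convex set** — the exchange property for the
bases of the uniform matroid `U_{d,T}`: if `α_i > β_i` (so `α_i = 1`, `β_i = 0`) then, as `|α| = |β| = d`, some `j` has
`α_j = 0 < 1 = β_j`, and `α - e_i + e_j` is squarefree of degree `d`, supported in `T` because `β_j ≠ 0`.
[cite: BrandenHuh2019, §2.2 (p. 11, exchange property for bases of a matroid and for M-convex sets)] -/
theorem isMConvex_setOf_squarefree (T : Set σ) (d : ℕ) :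
    IsMConvex {β : σ →₀ ℕ | (∀ i, β i ≤ 1) ∧ β.degree = d ∧ ∀ i, β i ≠ 0 → i ∈ T} := by
  classical
  rintro α β ⟨hα1, hαd, hαT⟩ ⟨hβ1, hβd, hβT⟩ i hi
  have hex : ∃ j, α j < β j := by
    by_contra h
    push Not at h
    have hlt := degree_lt_degree_of_le_of_lt (α := α) (β := β) (fun k ↦ h k) hi
    omega
  obtain ⟨j, hj⟩ := hex
  have hαi : α i ≠ 0 := by omega
  have hαj : α j = 0 := by have := hβ1 j; omega
  refine ⟨j, hj, fun k ↦ ?_, (degree_sub_single_add_single hαi j).trans hαd, fun k hk ↦ ?_⟩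
  · rw [Finsupp.add_apply, Finsupp.tsub_apply, Finsupp.single_apply, Finsupp.single_apply]
    have hk1 := hα1 k
    have hi1 := hα1 i
    by_cases hjk : j = k
    · have hαk : α k = 0 := hjk ▸ hαj
      rw [if_pos hjk]
      split_ifs <;> omega
    · rw [if_neg hjk]
      split_ifs <;> omega
  · simp only [Finsupp.add_apply, Finsupp.tsub_apply, Finsupp.single_apply] at hk
    by_cases hjk : j = k
    · subst hjk
      exact hβT j (by omega)
    · rw [if_neg hjk] at hk
      exact hαT k (by omega)

end Squarefree

/-! ## §3 `e_d(T) = Σ_{t ⊆ T, #t = d} Π_{i ∈ t} w_i`: coefficients, support, homogeneity -/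

section EsymmOn

/-- **The elementary symmetric polynomial of degree `d` in the variables `w_i`, `i ∈ T`**:
`e_d(T) = Σ_{t ⊆ T, #t = d} Π_{i ∈ t} w_i = Σ_t w^{e_t}` (`esymmOn_eq_sum_prod`); for `T = σ` this is Mathlib's
`MvPolynomial.esymm σ ℝ d` (`esymm_eq_esymmOn`). The restricted form is what the derivatives of `e_d` are
(`iterPderiv_ind_esymmOn`). [cite: BrandenHuh2019, §2.4 Example 2.27 ("elementary symmetric polynomials")] -/
def esymmOn (T : Finset σ) (d : ℕ) : MvPolynomial σ ℝ := ∑ t ∈ T.powersetCard d, monomial (ind t) 1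

/-- `e_d(T) = Σ_{t ⊆ T, #t = d} w^{e_t}`. [cite: BrandenHuh2019, §2.4 Example 2.27] -/
theorem esymmOn_def (T : Finset σ) (d : ℕ) : esymmOn T d = ∑ t ∈ T.powersetCard d, monomial (ind t) 1 := rfl

/-- `e_d(T) = Σ_{t ⊆ T, #t = d} Π_{i ∈ t} w_i`. [cite: BrandenHuh2019, §2.4 Example 2.27] -/
theorem esymmOn_eq_sum_prod (T : Finset σ) (d : ℕ) : esymmOn T d = ∑ t ∈ T.powersetCard d, ∏ i ∈ t, X i := by
  rw [esymmOn]
  refine Finset.sum_congr rfl fun t _ ↦ ?_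
  rw [ind, monomial_sum_one]
  exact Finset.prod_congr rfl fun i _ ↦ (X_pow_eq_monomial.symm.trans (pow_one (X i)))

/-- Mathlib's `esymm σ ℝ d = e_d(σ)` is `esymmOn univ d`. [cite: BrandenHuh2019, §2.4 Example 2.27] -/
theorem esymm_eq_esymmOn [Fintype σ] (d : ℕ) : esymm σ ℝ d = esymmOn univ d :=
  MvPolynomial.esymm_eq_sum_monomial σ ℝ d

variable [DecidableEq σ]

/-- The exponents `e_t`, `t ⊆ T`, `#t = d`, are exactly the squarefree exponents of degree `d` supported in `T` (the
bases of the uniform matroid `U_{d,T}` as `0/1` vectors). [cite: BrandenHuh2019, §2.2 (p. 11, bases of a matroid)] -/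
theorem mem_image_ind_iff {T : Finset σ} {d : ℕ} {β : σ →₀ ℕ} :
    β ∈ (T.powersetCard d).image ind ↔ (∀ i, β i ≤ 1) ∧ β.degree = d ∧ β.support ⊆ T := by
  rw [Finset.mem_image]
  constructor
  · rintro ⟨t, ht, rfl⟩
    obtain ⟨htT, hcard⟩ := mem_powersetCard.1 ht
    exact ⟨ind_le_one t, (degree_ind t).trans hcard, by rwa [support_ind]⟩
  · rintro ⟨h1, hd, hT⟩
    exact ⟨β.support, mem_powersetCard.2 ⟨hT, by rw [← degree_eq_card_support h1, hd]⟩, (eq_ind_support h1).symm⟩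

/-- **The coefficients of `e_d(T)`**: `coeff_β e_d(T) = 1` if `β = e_t` for some `t ⊆ T`, `#t = d` — i.e. (`mem_image_ind_iff`)
if `β` is squarefree of degree `d` with support in `T` — and `0` otherwise. [cite: BrandenHuh2019, §2.4 Example 2.27 (via
Thm. 2.25: "the support of `f`")] -/
theorem coeff_esymmOn (T : Finset σ) (d : ℕ) (β : σ →₀ ℕ) :
    coeff β (esymmOn T d) = if β ∈ (T.powersetCard d).image ind then 1 else 0 := by
  rw [esymmOn, coeff_sum, ← Finset.sum_ite_eq' ((T.powersetCard d).image ind) β (fun _ ↦ (1 : ℝ)),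
    Finset.sum_image fun s _ t _ h ↦ ind_injective h]
  exact Finset.sum_congr rfl fun t _ ↦ coeff_monomial _ _ _

/-- `coeff_β e_d(T) ≠ 0` iff `β` is squarefree of degree `d` supported in `T`. [cite: BrandenHuh2019, §2.4 Example 2.27 (via
Thm. 2.25: "the support of `f`")] -/
theorem coeff_esymmOn_ne_zero_iff {T : Finset σ} {d : ℕ} {β : σ →₀ ℕ} :
    coeff β (esymmOn T d) ≠ 0 ↔ (∀ i, β i ≤ 1) ∧ β.degree = d ∧ β.support ⊆ T := by
  rw [coeff_esymmOn, ← mem_image_ind_iff]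
  split_ifs with h
  · simp only [ne_eq, one_ne_zero, not_false_eq_true, true_iff]; exact h
  · simp only [ne_eq, not_true_eq_false, false_iff]; exact h

/-- The coefficients of `e_d(T)` are `0` or `1`, in particular nonnegative. [cite: BrandenHuh2019, §2.4 Example 2.27
("with nonnegative coefficients")] -/
theorem coeff_esymmOn_nonneg (T : Finset σ) (d : ℕ) (β : σ →₀ ℕ) : 0 ≤ coeff β (esymmOn T d) := by
  rw [coeff_esymmOn]
  split_ifs <;> norm_num

/-- **The support of `e_d(T)`** is the set of squarefree exponents of degree `d` supported in `T` (the bases of `U_{d,T}`).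
[cite: BrandenHuh2019, §2.4 Example 2.27 (via Thm. 2.25: "the support of `f` is M-convex")] -/
theorem support_esymmOn (T : Finset σ) (d : ℕ) :
    {β : σ →₀ ℕ | coeff β (esymmOn T d) ≠ 0} = {β | (∀ i, β i ≤ 1) ∧ β.degree = d ∧ ∀ i, β i ≠ 0 → i ∈ (T : Set σ)} := by
  ext β
  rw [Set.mem_setOf_eq, Set.mem_setOf_eq, coeff_esymmOn_ne_zero_iff]
  have hsub : β.support ⊆ T ↔ ∀ i, β i ≠ 0 → i ∈ (T : Set σ) :=
    ⟨fun h i hi ↦ h (Finsupp.mem_support_iff.2 hi), fun h i hi ↦ h i (Finsupp.mem_support_iff.1 hi)⟩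
  rw [hsub]

/-- **The support of `e_d(T)` is M-convex.** [cite: BrandenHuh2019, §2.4 Example 2.27; §2.2 (p. 11)] -/
theorem isMConvex_support_esymmOn (T : Finset σ) (d : ℕ) : IsMConvex {β : σ →₀ ℕ | coeff β (esymmOn T d) ≠ 0} := by
  rw [support_esymmOn]
  exact isMConvex_setOf_squarefree (T : Set σ) d

omit [DecidableEq σ] in
/-- `e_d(T)` is homogeneous of degree `d`. [cite: BrandenHuh2019, §2.4 Example 2.27 ("degree `d` homogeneous")] -/
theorem isHomogeneous_esymmOn (T : Finset σ) (d : ℕ) : (esymmOn T d).IsHomogeneous d := by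
  rw [esymmOn]
  exact IsHomogeneous.sum _ _ _ fun t ht ↦ isHomogeneous_monomial _ ((degree_ind t).trans (mem_powersetCard.1 ht).2)

variable [Fintype σ]

/-- Normalized and ordinary coefficients of `e_d(T)` agree (`c_β = β! coeff_β`, and `β! = 1` or `coeff_β = 0`).
[cite: BrandenHuh2019, §2.2 (p. 11, normalized form)] -/
theorem normCoeff_esymmOn (T : Finset σ) (d : ℕ) (β : σ →₀ ℕ) : normCoeff β (esymmOn T d) = coeff β (esymmOn T d) := by
  by_cases h : ∀ i, β i ≤ 1
  · exact normCoeff_eq_coeff_of_le_one h _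
  · have h0 : coeff β (esymmOn T d) = 0 := by
      by_contra hne
      exact h (coeff_esymmOn_ne_zero_iff.1 hne).1
    rw [h0]
    exact normCoeff_eq_zero_iff.2 h0

/-! ## §4 The derivatives `∂^{e_S} e_d(T) = e_{d-#S}(T ∖ S)` -/

/-- **`∂^{e_S} e_{#S+k}(T) = e_k(T ∖ S)` for `S ⊆ T`**: differentiating the squarefree polynomial `e_d(T)` once in each
variable of `S` keeps exactly the monomials `w^{e_t}` with `t ⊇ S` and strips `S` (normalized coefficients shift:
`c_β(∂^α f) = c_{α+β}(f)`). [cite: BrandenHuh2019, §2.4 Example 2.27 (the check via Thm. 2.25: "`∂^α f` […] for every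
`α ∈ Δ^{d-2}_n`"); §2.2 (p. 11, "`f ∈ M^d_n` implies `∂_i f ∈ M^{d-1}_n`")] -/
theorem iterPderiv_ind_esymmOn {S T : Finset σ} (hST : S ⊆ T) (k : ℕ) :
    iterPderiv (ind S) (esymmOn T (S.card + k)) = esymmOn (T \ S) k := by
  ext β
  -- the two `0/1` conditions agree
  have hiff : ind S + β ∈ (T.powersetCard (S.card + k)).image ind ↔ β ∈ ((T \ S).powersetCard k).image ind := by
    rw [mem_image_ind_iff, mem_image_ind_iff]
    constructor
    · rintro ⟨h1, hd, hT⟩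
      refine ⟨fun i ↦ ?_, ?_, fun i hi ↦ ?_⟩
      · exact le_trans (by rw [Finsupp.add_apply]; exact Nat.le_add_left _ _) (h1 i)
      · rw [map_add, degree_ind] at hd
        omega
      · have hβi := Finsupp.mem_support_iff.1 hi
        have h1i := h1 i
        rw [Finsupp.add_apply, ind_apply] at h1i
        rw [Finset.mem_sdiff]
        refine ⟨hT (Finsupp.mem_support_iff.2 ?_), fun hiS ↦ ?_⟩
        · rw [Finsupp.add_apply]; omega
        · rw [if_pos hiS] at h1i; omega
    · rintro ⟨h1, hd, hT⟩
      refine ⟨fun i ↦ ?_, ?_, fun i hi ↦ ?_⟩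
      · rw [Finsupp.add_apply, ind_apply]
        by_cases hiS : i ∈ S
        · have hβi : β i = 0 := by
            by_contra hne
            exact (Finset.mem_sdiff.1 (hT (Finsupp.mem_support_iff.2 hne))).2 hiS
          rw [if_pos hiS, hβi]
        · rw [if_neg hiS, zero_add]; exact h1 i
      · rw [map_add, degree_ind, hd]
      · rw [Finsupp.mem_support_iff, Finsupp.add_apply] at hi
        by_cases hiS : i ∈ S
        · exact hST hiS
        · rw [ind_apply, if_neg hiS, zero_add] at hi
          exact (Finset.mem_sdiff.1 (hT (Finsupp.mem_support_iff.2 hi))).1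
  have key : normCoeff β (iterPderiv (ind S) (esymmOn T (S.card + k))) = normCoeff β (esymmOn (T \ S) k) := by
    rw [normCoeff_iterPderiv, normCoeff_esymmOn, normCoeff_esymmOn, coeff_esymmOn, coeff_esymmOn]
    exact if_congr hiff rfl rfl
  rwa [normCoeff, normCoeff, mul_right_inj' (factorialProd_ne_zero β)] at key

/-- `∂^α e_d(T) = 0` when `α` is not squarefree or involves a variable outside `T` (no monomial of `e_d(T)` is divisible
by `w^α`). [cite: BrandenHuh2019, §2.4 Example 2.27 (the check via Thm. 2.25)] -/
theorem iterPderiv_esymmOn_eq_zero {α : σ →₀ ℕ} {T : Finset σ} (d : ℕ) (h : ¬ ((∀ i, α i ≤ 1) ∧ α.support ⊆ T)) :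
    iterPderiv α (esymmOn T d) = 0 := by
  ext β
  rw [coeff_zero, ← normCoeff_eq_zero_iff, normCoeff_iterPderiv, normCoeff_esymmOn]
  by_contra hne
  obtain ⟨h1, -, hT⟩ := coeff_esymmOn_ne_zero_iff.1 hne
  refine h ⟨fun i ↦ le_trans (by rw [Finsupp.add_apply]; exact Nat.le_add_right _ _) (h1 i), fun i hi ↦ hT ?_⟩
  rw [Finsupp.mem_support_iff] at hi ⊢
  rw [Finsupp.add_apply]
  omega

/-! ## §5 The Hessian of `e_2(U)` has exactly one positive eigenvalue; `e_d(T) ∈ L^d_n` -/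

/-- **The Hessian of `e_2(U)`**: `𝓗_{ij} = ∂_i ∂_j e_2(U) = [i ≠ j, i ∈ U, j ∈ U]` (the adjacency matrix of the complete
graph on `U`). [cite: BrandenHuh2019, §2.4 Example 2.27 (the check via Thm. 2.25: "`∂^α f` has at most one positive
eigenvalue")] -/
theorem hessian_esymmOn_two (U : Finset σ) (i j : σ) :
    hessian (esymmOn U 2) i j = if i ≠ j ∧ i ∈ U ∧ j ∈ U then 1 else 0 := by
  have hiff : coeff (Finsupp.single i 1 + Finsupp.single j 1) (esymmOn U 2) ≠ 0 ↔ i ≠ j ∧ i ∈ U ∧ j ∈ U := by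
    rw [coeff_esymmOn_ne_zero_iff]
    constructor
    · rintro ⟨h1, -, hT⟩
      refine ⟨fun hij ↦ ?_, hT ?_, hT ?_⟩
      · have h := h1 i
        subst hij
        rw [Finsupp.add_apply, Finsupp.single_eq_same] at h
        omega
      · rw [Finsupp.mem_support_iff, Finsupp.add_apply, Finsupp.single_eq_same]; omega
      · rw [Finsupp.mem_support_iff, Finsupp.add_apply, Finsupp.single_eq_same]; omega
    · rintro ⟨hij, hi, hj⟩
      refine ⟨fun k ↦ ?_, by rw [map_add, Finsupp.degree_single, Finsupp.degree_single], fun k hk ↦ ?_⟩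
      · rw [Finsupp.add_apply, Finsupp.single_apply, Finsupp.single_apply]
        by_cases hik : i = k
        · rw [if_pos hik, if_neg (fun hjk ↦ hij (hik.trans hjk.symm))]
          omega
        · rw [if_neg hik]; split_ifs <;> omega
      · rw [Finsupp.mem_support_iff, Finsupp.add_apply, Finsupp.single_apply, Finsupp.single_apply] at hk
        by_cases hik : i = k
        · exact hik ▸ hi
        · by_cases hjk : j = k
          · exact hjk ▸ hj
          · rw [if_neg hik, if_neg hjk] at hk; exact (hk rfl).elim
  rw [hessian_apply_eq_normCoeff, normCoeff_esymmOn]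
  split_ifs with h
  · -- the coefficient is nonzero, hence `1`
    have hne := hiff.2 h
    rw [coeff_esymmOn] at hne ⊢
    split_ifs at hne with h' <;> simp_all
  · by_contra hne
    exact h (hiff.1 hne)

/-- **`𝓗_{e_2(U)}` has at most one positive eigenvalue**: its quadratic form is
`x ↦ Σ_{i ≠ j ∈ U} x_i x_j = (Σ_{i∈U} x_i)² - Σ_{i∈U} x_i²`, non-positive on the hyperplane `Σ_{i∈U} x_i = 0`, so
(Sylvester: a negative semidefinite subspace of codimension `≤ 1`) `sigPos ≤ 1`. [cite: BrandenHuh2019, §2.4 Example 2.27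
(the check via Thm. 2.25: "at most one positive eigenvalue")] -/
theorem sigPos_hessian_esymmOn_two_le_one (U : Finset σ) :
    sigPos (Matrix.toBilin' (hessian (esymmOn U 2))).toQuadraticMap ≤ 1 := by
  set Q := (Matrix.toBilin' (hessian (esymmOn U 2))).toQuadraticMap with hQ
  -- the functional `ℓ x = Σ_{i ∈ U} x_i`; write `a_i = [i ∈ U] x_i`
  set ℓ : (σ → ℝ) →ₗ[ℝ] ℝ := ∑ i ∈ U, LinearMap.proj i with hℓ
  have hℓx : ∀ x : σ → ℝ, ℓ x = ∑ i, if i ∈ U then x i else 0 := fun x ↦ by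
    rw [hℓ, LinearMap.sum_apply, Finset.sum_ite_mem, Finset.univ_inter]
    rfl
  have hterm : ∀ (x : σ → ℝ) (i j : σ), x i * hessian (esymmOn U 2) i j * x j =
      (if i ∈ U then x i else 0) * (if j ∈ U then x j else 0) -
        if j = i then (if i ∈ U then x i else 0) * (if i ∈ U then x i else 0) else 0 := by
    intro x i j
    rw [hessian_esymmOn_two]
    by_cases hji : j = i
    · subst hji
      simp
    · rw [if_neg hji, sub_zero]
      by_cases hi : i ∈ U <;> by_cases hj : j ∈ U <;> simp [hi, hj, Ne.symm hji]
  have hQx : ∀ x : σ → ℝ, Q x = (∑ i, if i ∈ U then x i else 0) * (∑ i, if i ∈ U then x i else 0) -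
      ∑ i, (if i ∈ U then x i else 0) * (if i ∈ U then x i else 0) := fun x ↦ by
    rw [hQ, LinearMap.BilinMap.toQuadraticMap_apply, Matrix.toBilin'_apply]
    simp_rw [hterm, Finset.sum_sub_distrib]
    rw [Finset.sum_mul_sum]
    congr 1
    exact Finset.sum_congr rfl fun i _ ↦ by rw [Finset.sum_ite_eq' Finset.univ i, if_pos (Finset.mem_univ i)]
  have hN : ∀ x ∈ LinearMap.ker ℓ, Q x ≤ 0 := fun x hx ↦ by
    rw [LinearMap.mem_ker, hℓx] at hx
    rw [hQx, hx, mul_zero, zero_sub, neg_nonpos]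
    exact Finset.sum_nonneg fun i _ ↦ mul_self_nonneg _
  have h2 := QuadraticForm.sigPos_add_finrank_le_of_nonpos hN
  have hr : Module.finrank ℝ (LinearMap.range ℓ) ≤ 1 :=
    (Submodule.finrank_le _).trans (Module.finrank_self ℝ).le
  have h3 := ℓ.finrank_range_add_finrank_ker
  omega

/-- **`e_2(U) ∈ L²_n`**: a quadratic form with nonnegative coefficients, M-convex support and Hessian with at most one
positive eigenvalue. [cite: BrandenHuh2019, §2.4 Example 2.27; §2.2 Def. 2.6 (`L²_n`)] -/
theorem esymmOn_two_mem_lorentzian (U : Finset σ) : esymmOn U 2 ∈ lorentzian σ 2 :=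
  mem_lorentzian_two.2 ⟨isHomogeneous_esymmOn U 2, coeff_esymmOn_nonneg U 2, isMConvex_support_esymmOn U 2,
    sigPos_hessian_esymmOn_two_le_one U⟩

/-- **`e_d(T) ∈ L^d_n` for every `d` and every set of variables `T`** — Example 2.27 carried out with the second form of
Definition 2.6: `e_d(T) ∈ M^d_n` (§3) and every `∂^α e_d(T)`, `|α| = d - 2`, is `e_2(T ∖ supp α)` or `0`, both in `L²_n`.
[cite: BrandenHuh2019, §2.4 Example 2.27 ("it is straightforward to check that elementary symmetric polynomials are
Lorentzian"); §2.2 Def. 2.6] -/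
theorem esymmOn_mem_lorentzian (T : Finset σ) : ∀ d : ℕ, esymmOn T d ∈ lorentzian σ d
  | 0 => mem_lorentzian_zero.2 ⟨isHomogeneous_esymmOn T 0, coeff_esymmOn_nonneg T 0⟩
  | 1 => mem_lorentzian_one.2 ⟨isHomogeneous_esymmOn T 1, coeff_esymmOn_nonneg T 1⟩
  | m + 2 => by
    refine mem_lorentzian_iff_forall_iterPderiv.2
      ⟨⟨isHomogeneous_esymmOn T _, coeff_esymmOn_nonneg T _, isMConvex_support_esymmOn T _⟩, fun α hα ↦ ?_⟩
    by_cases h : (∀ i, α i ≤ 1) ∧ α.support ⊆ T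
    · obtain ⟨h1, hT⟩ := h
      have hcard : α.support.card = m := by rw [← degree_eq_card_support h1, hα]
      rw [eq_ind_support h1, show m + 2 = α.support.card + 2 by rw [hcard], iterPderiv_ind_esymmOn hT 2]
      exact esymmOn_two_mem_lorentzian _
    · rw [iterPderiv_esymmOn_eq_zero _ h]
      exact zero_mem_lorentzian 2

/-- **Brändén–Huh, Example 2.27: the elementary symmetric polynomials are Lorentzian** —
`e_d(w_1, …, w_n) = Σ_{#t = d} Π_{i ∈ t} w_i ∈ L^d_n` (Mathlib's `MvPolynomial.esymm σ ℝ d`), for every `d` and every finite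
set of variables. [cite: BrandenHuh2019, §2.4 Example 2.27] -/
theorem esymm_mem_lorentzian (d : ℕ) : esymm σ ℝ d ∈ lorentzian σ d := by
  rw [esymm_eq_esymmOn]
  exact esymmOn_mem_lorentzian univ d

end EsymmOn

end Literature.Combinatorics.LorentzianPolynomials

end
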